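import Summits.CriticalPhenomena.Ising3DConformalLimit.Theses.SynchronousCoupling
import Literature.Probability.LatticeModels.GibbsSpecification
import Literature.Probability.LatticeModels.CriticalGibbsUniqueness
import Literature.Probability.LatticeModels.HighDimTrivialityMomentsProofs
import HarnessLib

/-!
# Route `SynchronousCoupling`, crux `DilationJoinings` (stmt-CriticalPhenomena-18762), line `Sketch` —
stub `stub_blockMomentPos`

Block second moments of a critical DLR state of the n.n. Ising model on `ℤ³` are positive: for every
`μ ∈ 𝒢(β_c, 0)` and every `n ≥ 1`,

  `0 < ∫ (∑_{x ∈ [0,n)³} σ_x)² dμ`.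

This is the positivity of the normalisers `N_ℓ = √⟨S_ℓ²⟩` of the self-normalised block spins used by
the glue of the line `Sketch` (`DilationJoinings_proof`).

Proof. `μ` is a probability measure (DLR condition). Uniqueness at `β_c` in `d = 3` (tree theorem
`hasUniqueGibbsMeasure_criticalBeta_holds`) identifies the correlations of `μ` with the free
correlations (`spinCorr_eq_freeCorr_of_hasUniqueGibbsMeasure`), so GKS I (`freeCorr_nonneg`) gives
`⟨σ_x σ_y⟩_μ ≥ 0` for all `x, y`. Expanding the square, `⟨(∑_x σ_x)²⟩ = ∑_x ∑_y ⟨σ_x σ_y⟩` is a sum of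
non-negative terms whose diagonal terms are `⟨σ_x²⟩ = 1`; the box `[0,n)³` contains the origin, so the
sum is `≥ 1 > 0`.

References: Friedli–Velenik 2017, Thm. 3.20 (GKS I) and Exercise 3.16 / Thm. 6.26 (the free state);
Aizenman–Duminil-Copin–Sidoravicius, CMP 334 (2015), Thm. 1.2 (uniqueness at `β_c`, `d = 3`) — all
theorems of the tree. [folklore]
-/

noncomputable section

namespace Summit.CriticalPhenomena.Ising3DConformalLimit.Cruxes.DilationJoinings.Sketch

open MeasureTheory Literature.Probability.LatticeModels

/-- **GKS I for a critical DLR state on `ℤ³`.** For `μ ∈ 𝒢(β_c, 0)` (`d = 3`) and all sites `x, y`,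
`0 ≤ ⟨σ_x σ_y⟩_μ`: by uniqueness at `β_c` (`hasUniqueGibbsMeasure_criticalBeta_holds`) the state `μ`
has the free correlations, which are non-negative (`freeCorr_nonneg`); the diagonal `x = y` is
`⟨σ_x²⟩ = 1 ≥ 0`. (Friedli–Velenik 2017, Thm. 3.20 with Exercise 3.16.) [folklore] -/
theorem blockMomentPos_pairCorr_nonneg {μ : Measure (SpinConfig (Site 3))}
    (hμ : μ ∈ isingGibbsMeasures 3 (criticalBeta 3) 0) (x y : Site 3) :
    0 ≤ ∫ σ, spinAt x σ * spinAt y σ ∂μ := by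
  have hβ : 0 ≤ criticalBeta 3 := criticalBeta_nonneg 3
  haveI : IsProbabilityMeasure μ :=
    ((mem_isingGibbsMeasures_iff _ _ _ _).1 hμ).isProbabilityMeasure
  by_cases hxy : x = y
  · subst hxy; simp
  · have hpair : (∫ σ, spinAt x σ * spinAt y σ ∂μ) = spinCorr μ {x, y} := by
      simp only [spinCorr, spinProduct, Finset.prod_pair hxy]
    rw [hpair, spinCorr_eq_freeCorr_of_hasUniqueGibbsMeasure hβ
      (hasUniqueGibbsMeasure_criticalBeta_holds (d := 3) (by norm_num)) hμ]
    exact freeCorr_nonneg hβ le_rfl _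

/-- **The row sums of the pair-correlation matrix of a critical DLR state are `≥ 1`.** For
`μ ∈ 𝒢(β_c, 0)` on `ℤ³`, a finite set of sites `B` and `x ∈ B`,
`1 ≤ ∫ ∑_{y ∈ B} σ_x σ_y dμ`: the diagonal term is `⟨σ_x²⟩ = 1` and the others are `≥ 0`
(`blockMomentPos_pairCorr_nonneg`). [folklore] -/
theorem blockMomentPos_one_le_rowSum {μ : Measure (SpinConfig (Site 3))}
    (hμ : μ ∈ isingGibbsMeasures 3 (criticalBeta 3) 0) (B : Finset (Site 3)) {x : Site 3}
    (hx : x ∈ B) : 1 ≤ ∫ σ, ∑ y ∈ B, spinAt x σ * spinAt y σ ∂μ := by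
  haveI : IsProbabilityMeasure μ :=
    ((mem_isingGibbsMeasures_iff _ _ _ _).1 hμ).isProbabilityMeasure
  rw [integral_finsetSum _ fun y _ => integrable_spinAt_mul_spinAt μ x y]
  calc (1 : ℝ) = ∫ σ, spinAt x σ * spinAt x σ ∂μ := by simp
    _ ≤ ∑ y ∈ B, ∫ σ, spinAt x σ * spinAt y σ ∂μ :=
      Finset.single_le_sum (f := fun y => ∫ σ, spinAt x σ * spinAt y σ ∂μ)
        (fun y _ => blockMomentPos_pairCorr_nonneg hμ x y) hx

/-- **Stub 1 of the line `Sketch` (block second moments are positive).** For every critical DLR state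
`μ` of the n.n. Ising model on `ℤ³` and every `n ≥ 1`, `0 < ∫ (∑_{x ∈ [0,n)³} σ_x)² dμ`: uniqueness at
`β_c` + GKS I make every pair correlation non-negative, and the diagonal `σ_x² = 1` at the origin
`0 ∈ [0,n)³` contributes `1`. [folklore] -/
theorem stub_blockMomentPos :
    ∀ μ ∈ isingGibbsMeasures 3 (criticalBeta 3) 0, ∀ n : ℤ, 1 ≤ n →
      0 < ∫ σ, (∑ x ∈ Fintype.piFinset (fun _ : Fin 3 => Finset.Ico (0:ℤ) n), spinAt x σ) ^ 2 ∂μ := by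
  intro μ hμ n hn
  haveI : IsProbabilityMeasure μ :=
    ((mem_isingGibbsMeasures_iff _ _ _ _).1 hμ).isProbabilityMeasure
  set B : Finset (Site 3) := Fintype.piFinset (fun _ : Fin 3 => Finset.Ico (0:ℤ) n) with hB
  have h0 : (fun _ : Fin 3 => (0:ℤ)) ∈ B := by
    rw [hB, Fintype.mem_piFinset]
    intro i
    exact Finset.mem_Ico.2 ⟨le_rfl, by omega⟩
  have hexp : ∀ σ : SpinConfig (Site 3), (∑ x ∈ B, spinAt x σ) ^ 2 =
      ∑ x ∈ B, ∑ y ∈ B, spinAt x σ * spinAt y σ := fun σ => by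
    rw [sq, Finset.sum_mul_sum]
  simp_rw [hexp]
  rw [integral_finsetSum _ fun x _ =>
    integrable_finsetSum _ fun y _ => integrable_spinAt_mul_spinAt μ x y]
  have hrow : ∀ x ∈ B, 0 ≤ ∫ σ, ∑ y ∈ B, spinAt x σ * spinAt y σ ∂μ := fun x hx =>
    zero_le_one.trans (blockMomentPos_one_le_rowSum hμ B hx)
  calc (0 : ℝ) < 1 := one_pos
    _ ≤ ∫ σ, ∑ y ∈ B, spinAt (fun _ : Fin 3 => (0:ℤ)) σ * spinAt y σ ∂μ :=
      blockMomentPos_one_le_rowSum hμ B h0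
    _ ≤ ∑ x ∈ B, ∫ σ, ∑ y ∈ B, spinAt x σ * spinAt y σ ∂μ :=
      Finset.single_le_sum (f := fun x => ∫ σ, ∑ y ∈ B, spinAt x σ * spinAt y σ ∂μ) hrow h0

end Summit.CriticalPhenomena.Ising3DConformalLimit.Cruxes.DilationJoinings.Sketch

end
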